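import Summits.Parity.GeneralizedHardyLittlewood.Theorems.GreenTaoLevelTwoMNTwoAlmostLinearThreeTermSum
import Summits.Parity.GeneralizedHardyLittlewood.Theorems.GreenTaoLevelTwoMNTwoMajorArcThreeTerm

/-!
# Route `GreenTaoLevelTwo`, crux `MNTwo` (stmt-Parity-21276), line `birth`, stub `stub_mnVertical`:
# Möbius is orthogonal to a localized piece of a major-arc locally quadratic phase (GT 2008b §12)

Block V6 of the `stub_mnVertical` census, LOCAL CORE (B. Green, T. Tao, *Quadratic uniformity of the
Möbius function*, Ann. Inst. Fourier 58 (2008) = arXiv:math/0606087, §12 "Handling the major arcs":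
"Let `q` be as above [Lemma 28: `‖qφ''(h,h')‖ ≲ ‖h‖_g‖h'‖_g` on `B_g(0,ρ₃)`] … we conclude the
approximate linearity relationship (star-1) … cover `B_g(n₀,ρ₀)` with `O(ε^{-C})` Bohr sets
`B_g(n_α,ε)` … partition of `ψ` into … `ψ_α`, each supported on a Bohr set `B_g(n_α,ε)` … apply
Proposition 15 (with `ρ = ε`) to conclude that for any `κ ≤ ε` …
`|𝔼_{N<n≤2N} μ(n)ψ_α(n)e(−φ(n))| ≪ κ^{-C} q³ log^{-A'} N + (ε + κ) 𝔼|ψ_α|`").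
This def-free file proves the estimate for ONE localized piece `ψ_α`, in abstract form: the
`1`-step Bohr norm is any nonnegative subadditive gauge `ν` on `ℤ`, `φ : ℤ → ℝ/ℤ` is locally
quadratic on the gauge ball `B(n₀,R)` (eight-point hypothesis) with the major-arc bound
`‖q•φ''(a,b)‖ ≤ K ν(a)ν(b)` (`ν a, ν b < ρ`), the piece `ψ` (`0 ≤ ψ ≤ 1`) is supported in
`(N,2N] ∩ B(n₀,r₁)` with gauge-diameter `< 2r`, and the shifts are `H ⊆ q·{a : ν a < η}`
(`0 ∈ H`, `|h| ≤ N`, `#H ≥ δN`).  It is the composition of the three-term Prop. 15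
(`…MNTwoAlmostLinearThreeTermSum`) with the bridge `…MNTwoMajorArcThreeTerm`.  What remains for
§12 proper is bookkeeping: the partition of `ψ` into such pieces (torus partition of unity at
scale `r`), the rotation-Bohr instantiation of `ν` with `#H ≫ (η/16)^{k+1}N` (Lemma 14 (a),
`…MNTwoRotationBohrSize`), and the choice `η ≍ r ≍ log^{-C(A+1)} N`.

* `norm_sum_moebius_major_arc_piece_le` — for every `A > 0` there is `C ≥ 0` with
  `‖Σ_{N<n≤2N} μ(n)ψ(n)e(−φ(n))‖ ≤ C q/√δ · N/log^A N + 2π K η (qη + 4r) Σψ + Σ_{(N,2N]} w`.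

References: [GreenTao2008QuadraticMobius] arXiv:math/0606087 §12 (with Prop. 15, Lemma 28).
-/

noncomputable section

open Finset Real ArithmeticFunction
open scoped ArithmeticFunction.Moebius

namespace Summit.Parity.GeneralizedHardyLittlewood.GreenTaoLevelTwoMNTwoMajorArcLocal

open Summit.Parity.GeneralizedHardyLittlewood.GreenTaoLevelTwoMNTwoAlmostLinearThreeTermSum
  (norm_sum_moebius_almost_linear_le_of_three_term)
open Summit.Parity.GeneralizedHardyLittlewood.GreenTaoLevelTwoMNTwoMajorArcThreeTerm
  (three_term_bound_of_major_arc)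

/-- **Möbius vs. one localized piece of a major-arc locally quadratic phase (GT 2008b §12).**
For every `A > 0` there is `C ≥ 0` such that the following holds.  Let `N ≥ 2`, `q ≥ 1`; `ν` a
nonnegative subadditive gauge on `ℤ` with `ν 0 = 0`; `φ : ℤ → ℝ/ℤ` locally quadratic on the gauge
ball `B(n₀, R)` with the major-arc bound `‖q • φ''(a,b)‖ ≤ K ν(a) ν(b)` for `ν a, ν b < ρ`
(`K ≥ 0`, `r₁ + 2ρ ≤ R`, `3ρ ≤ R`); radii `0 < η`, `0 ≤ r` with `qη ≤ ρ`, `2r ≤ ρ`; shifts `H ∋ 0`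
with `#H ≥ δN`, `|h| ≤ N` and `h = q a`, `ν a < η` for `h ∈ H`; a piece `0 ≤ ψ ≤ 1` supported in
`(N,2N] ∩ B(n₀, r₁)` of gauge-diameter `< 2r`, with shift bound `|ψ(n+h₁+h₂) − ψ(n)| ≤ w(n)`
(`h₁, h₂ ∈ H`, `w ≥ 0`).  Then
`‖Σ_{N<n≤2N} μ(n)ψ(n)e(−φ(n))‖ ≤ C q/√δ · N/log^A N + 2π K η (qη + 4r) Σ_{(N,2N]} ψ + Σ_{(N,2N]} w`.
[cite: GreenTao2008QuadraticMobius, §12] -/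
theorem norm_sum_moebius_major_arc_piece_le {A : ℝ} (hA : 0 < A) :
    ∃ C : ℝ, 0 ≤ C ∧ ∀ N : ℕ, 2 ≤ N → ∀ q : ℕ, 1 ≤ q →
      ∀ (ν : ℤ → ℝ), ν 0 = 0 → (∀ x, 0 ≤ ν x) → (∀ x y, ν (x + y) ≤ ν x + ν y) →
      ∀ (φ : ℤ → UnitAddCircle) (n₀ : ℤ) (R K ρ r₁ r η : ℝ),
      (∀ n a b c : ℤ, ν (n - n₀) < R → ν (n + a - n₀) < R → ν (n + b - n₀) < R →
        ν (n + c - n₀) < R → ν (n + a + b - n₀) < R → ν (n + a + c - n₀) < R →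
        ν (n + b + c - n₀) < R → ν (n + a + b + c - n₀) < R →
        φ (n + a + b + c) - φ (n + a + b) - φ (n + a + c) - φ (n + b + c)
          + φ (n + a) + φ (n + b) + φ (n + c) - φ n = 0) →
      0 ≤ K → 0 < η →
      (∀ a b : ℤ, ν a < ρ → ν b < ρ →
        ‖q • (φ (n₀ + a + b) - φ (n₀ + a) - φ (n₀ + b) + φ n₀)‖ ≤ K * ν a * ν b) →
      r₁ + 2 * ρ ≤ R → 3 * ρ ≤ R → 0 ≤ r → 2 * r ≤ ρ → (q : ℝ) * η ≤ ρ →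
      ∀ (H : Finset ℤ) (δ : ℝ), 0 < δ → δ * N ≤ #H → (0 : ℤ) ∈ H →
      (∀ h ∈ H, |h| ≤ N ∧ ∃ a : ℤ, h = q * a ∧ ν a < η) →
      ∀ (ψ w : ℤ → ℝ),
      (∀ n, 0 ≤ ψ n) → (∀ n, ψ n ≤ 1) → (∀ n, ψ n ≠ 0 → (N : ℤ) < n ∧ n ≤ 2 * N) →
      (∀ n, ψ n ≠ 0 → ν (n - n₀) < r₁) → (∀ n n', ψ n ≠ 0 → ψ n' ≠ 0 → ν (n - n') < 2 * r) →
      (∀ n, 0 ≤ w n) → (∀ n, ∀ h₁ ∈ H, ∀ h₂ ∈ H, |ψ (n + h₁ + h₂) - ψ n| ≤ w n) →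
      ‖∑ n ∈ Ioc N (2 * N),
          ((μ n : ℝ) : ℂ) * ((ψ n : ℝ) : ℂ) * ((AddCircle.toCircle (-φ n) : Circle) : ℂ)‖ ≤
        C * q / Real.sqrt δ * N / Real.log N ^ A +
          2 * Real.pi * (K * η * (q * η + 4 * r)) * ∑ n ∈ Ioc N (2 * N), ψ n +
            ∑ n ∈ Ioc N (2 * N), w n := by
  obtain ⟨C, hC0, hC⟩ := norm_sum_moebius_almost_linear_le_of_three_term hA
  refine ⟨C, hC0, ?_⟩
  intro N hN q hq ν hν0 hνnn hνadd φ n₀ R K ρ r₁ r η hφ hK hη hMA hR hρR hr0 hr hqη H δ hδ hδH h0H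
    hH ψ w hψ0 hψ1 hsupp hloc hdiam hw0 hw
  have hHq : ∀ h ∈ H, |h| ≤ N ∧ (q : ℤ) ∣ h := fun h hh => by
    obtain ⟨h1, a, ha, _⟩ := hH h hh
    exact ⟨h1, ⟨a, ha⟩⟩
  have hq0 : (0 : ℝ) ≤ q := Nat.cast_nonneg _
  have hε : 0 ≤ K * η * (q * η + 4 * r) := by positivity
  refine hC N hN q hq H δ hδ hδH h0H hHq ψ w φ _ hε hψ0 hψ1 hsupp hw0 hw ?_
  intro n nₛ hn hns _ h₁ hh₁ h₂ hh₂
  obtain ⟨_, a₁, rfl, ha₁⟩ := hH h₁ hh₁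
  obtain ⟨_, a₂, rfl, ha₂⟩ := hH h₂ hh₂
  exact three_term_bound_of_major_arc ν hν0 hνnn hνadd φ hφ hq hK hη hMA hR hρR hr hqη (hloc n hn)
    (hloc nₛ hns) (hdiam n nₛ hn hns) ha₁ ha₂

end Summit.Parity.GeneralizedHardyLittlewood.GreenTaoLevelTwoMNTwoMajorArcLocal
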